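import Summits.RiemannHypothesis.RiemannHypothesis.Theses.WeilComb
import Summits.RiemannHypothesis.RiemannHypothesis.Theorems.WeilCombCombSubcriticalStubArchDiag
import Summits.RiemannHypothesis.RiemannHypothesis.Theorems.WeilCombCombSubcriticalStubArchOffdiag
import Literature.NumberTheory.LFunctions.WeilExplicit
import Literature.NumberTheory.LFunctions.WeilArchimedeanMoments
import Literature.NumberTheory.LFunctions.WeilArchimedeanPositivityProofs
import Literature.NumberTheory.LFunctions.WeilMellinBounds
import Literature.NumberTheory.LFunctions.WeilWindowSimpleEven
import Literature.NumberTheory.LFunctions.WeilGroundEnergyProofs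

/-!
# Stub `stub_arch` of line `helson-dirichlet-slack` for crux `WeilComb.CombSubcritical`
(item stmt-RiemannHypothesis-1025, route route-RiemannHypothesis-WeilComb)

The archimedean term of Weil's functional on the comb autocorrelation.  With
`φ_ε = ε⁻¹ φ(·/ε)` (`tsupport φ ⊆ [-1, 1]`, `ε > 0`), `ψ_ε = φ_ε ⋆ φ̃_ε`, the comb
`g = Σ_{m ≤ M} a_m φ_ε(· − log m)` and its autocorrelation
`k = g ⋆ g̃ = Σ_{m, m' ≤ M} a_m conj(a_{m'}) τ_{log m − log m'} ψ_ε` (hypothesis `hA`, the landed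
`stub_autocorrelation`), we prove, for `M ≥ 1` and `8 ε M ≤ 1`,

`Re W_∞(k) ≥ ε⁻¹ ‖φ‖₂² (log(1/ε) − C) ‖a‖² − 2 ‖φ‖₂² (B_abs(a) + (Σ_m ‖a_m‖)²)`,

`B_abs(a) = Σ_{m ≠ m'} ‖a_m‖ ‖a_{m'}‖ / |log m − log m'|`, with the absolute constant `C` of the
landed sharp diagonal bound `stub_archDiag`.

Proof.  `W_∞` is linear over finite sums of Weil tests (`weilArchIntegral_add`,
`weilMellin_const_mul`), so `W_∞(k) = Σ_{m,m'} a_m conj(a_{m'}) W_∞(τ_{log m − log m'} ψ_ε)`.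
Diagonal `m = m'`: `τ_0 ψ_ε = ψ_ε = φ_ε ⋆ φ̃_ε`, `a_m conj a_m = ‖a_m‖²`, and `stub_archDiag` at
`(g, b) = (φ_ε, ε)` (`0 < ε ≤ 1`, `tsupport φ_ε ⊆ [-ε, ε]`) gives
`Re W_∞(ψ_ε) ≥ (log(1/ε) − C) ‖φ_ε‖₂² = (log(1/ε) − C) ε⁻¹ ‖φ‖₂²`.
Off-diagonal `m ≠ m'`: distinct `m, m' ∈ [1, M]` have `|log m − log m'| ≥ 1/(M+1) ≥ 1/(2M) ≥ 4ε`,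
so `stub_archOffdiag` gives `|W_∞(τ_x ψ_ε)| ≤ ‖φ‖₁² (1/|x| + 1)`, `x = log m − log m'`; summing,
`|Σ_{m ≠ m'} …| ≤ ‖φ‖₁² (B_abs(a) + Σ_{m ≠ m'} ‖a_m‖‖a_{m'}‖) ≤ ‖φ‖₁² (B_abs(a) + (Σ ‖a_m‖)²)`, and
`‖φ‖₁² ≤ 2 ‖φ‖₂²` (`weilNorm1_sq_le`, support in `[-1, 1]`).
-/

noncomputable section

open scoped BigOperators ComplexConjugate
open Complex MeasureTheory Set

namespace Summit.RiemannHypothesis.RiemannHypothesis.Theorems.WeilCombSubcritical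

open Literature.NumberTheory.LFunctions

/-! ### Private toolkit: dilation, linearity of `W_∞`, the Diophantine gap -/

/-- `φ_ε` is a Weil test function (`ε ≠ 0`). -/
private theorem isWeilTest_dil_arch {φ : ℝ → ℂ} {ε : ℝ} (hφ : IsWeilTest φ) (hε : ε ≠ 0) :
    IsWeilTest (fun t : ℝ => (ε : ℂ)⁻¹ * φ (t / ε)) := by
  have h1 : IsWeilTest (fun t : ℝ => φ (t / ε)) := by
    refine ⟨hφ.1.comp (contDiff_id.div_const ε), ?_⟩
    have e : (fun t : ℝ => φ (t / ε)) = φ ∘ (Homeomorph.mulRight₀ ε⁻¹ (inv_ne_zero hε)) := by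
      ext t
      simp [div_eq_mul_inv]
    rw [e]
    exact hφ.2.comp_homeomorph _
  exact h1.const_mul _

/-- `tsupport φ ⊆ [-1, 1]` gives `tsupport φ_ε ⊆ [-ε, ε]` (`ε > 0`). -/
private theorem tsupport_dil_subset_arch {φ : ℝ → ℂ} {ε : ℝ} (hsupp : tsupport φ ⊆ Icc (-1) 1)
    (hε : 0 < ε) : tsupport (fun t : ℝ => (ε : ℂ)⁻¹ * φ (t / ε)) ⊆ Icc (-ε) ε := by
  refine closure_minimal ?_ isClosed_Icc
  intro t ht
  rw [Function.mem_support] at ht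
  have hφ : φ (t / ε) ≠ 0 := fun h => ht (by simp [h])
  have hmem : t / ε ∈ Icc (-1 : ℝ) 1 := hsupp (subset_tsupport _ hφ)
  constructor
  · have h := hmem.1
    rw [le_div_iff₀ hε] at h
    linarith
  · have h := hmem.2
    rw [div_le_iff₀ hε] at h
    linarith

/-- `‖φ_ε‖₂² = ε⁻¹ ‖φ‖₂²` (`ε > 0`). -/
private theorem weilNorm2Sq_dil_arch (φ : ℝ → ℂ) {ε : ℝ} (hε : 0 < ε) :
    weilNorm2Sq (fun t : ℝ => (ε : ℂ)⁻¹ * φ (t / ε)) = ε⁻¹ * weilNorm2Sq φ := by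
  unfold weilNorm2Sq
  have e : (fun t : ℝ => ‖(ε : ℂ)⁻¹ * φ (t / ε)‖ ^ 2) = fun t => (ε⁻¹) ^ 2 * ‖φ (t / ε)‖ ^ 2 := by
    funext t
    rw [norm_mul, norm_inv, Complex.norm_real, Real.norm_eq_abs, abs_of_pos hε, mul_pow]
  rw [e, integral_const_mul, Measure.integral_comp_div (fun t => ‖φ t‖ ^ 2) ε, abs_of_pos hε,
    smul_eq_mul]
  field_simp

/-- `W_∞(c · k) = c · W_∞(k)` (no hypotheses). -/
private theorem weilArchTerm_const_mul_arch (c : ℂ) (k : ℝ → ℂ) :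
    weilArchTerm (fun t => c * k t) = c * weilArchTerm k := by
  have hAI : weilArchIntegral (fun t => c * k t) = c * weilArchIntegral k := by
    simp only [weilArchIntegral, weilMellin_const_mul]
    rw [← integral_const_mul]
    congr 1 with t
    ring
  simp only [weilArchTerm, hAI]
  ring

/-- `W_∞(k₁ + k₂) = W_∞(k₁) + W_∞(k₂)` for Weil tests. -/
private theorem weilArchTerm_add_arch {k₁ k₂ : ℝ → ℂ} (hk₁ : IsWeilTest k₁) (hk₂ : IsWeilTest k₂) :
    weilArchTerm (k₁ + k₂) = weilArchTerm k₁ + weilArchTerm k₂ := by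
  simp only [weilArchTerm, weilArchIntegral_add hk₁ hk₂, Pi.add_apply]
  ring

/-- Finite sums of Weil tests are Weil tests. -/
private theorem isWeilTest_finset_sum_arch {ι : Type*} (s : Finset ι) (F : ι → ℝ → ℂ)
    (hF : ∀ i ∈ s, IsWeilTest (F i)) : IsWeilTest (fun t => ∑ i ∈ s, F i t) := by
  classical
  induction s using Finset.induction_on with
  | empty =>
    simp only [Finset.sum_empty]
    exact ⟨contDiff_const, HasCompactSupport.zero⟩
  | insert a s ha ih =>
    have hF' : ∀ i ∈ s, IsWeilTest (F i) := fun i hi => hF i (Finset.mem_insert_of_mem hi)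
    have e : (fun t => ∑ i ∈ insert a s, F i t) = F a + fun t => ∑ i ∈ s, F i t := by
      funext t
      simp [Finset.sum_insert ha]
    rw [e]
    exact (hF a (Finset.mem_insert_self a s)).add (ih hF')

/-- `W_∞` is additive over finite sums of Weil tests. -/
private theorem weilArchTerm_finset_sum_arch {ι : Type*} (s : Finset ι) (F : ι → ℝ → ℂ)
    (hF : ∀ i ∈ s, IsWeilTest (F i)) :
    weilArchTerm (fun t => ∑ i ∈ s, F i t) = ∑ i ∈ s, weilArchTerm (F i) := by
  classical
  induction s using Finset.induction_on with
  | empty =>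
    simp only [Finset.sum_empty]
    have h := weilArchTerm_const_mul_arch 0 (fun _ : ℝ => (0 : ℂ))
    simp only [zero_mul] at h
    exact h
  | insert a s ha ih =>
    have hF' : ∀ i ∈ s, IsWeilTest (F i) := fun i hi => hF i (Finset.mem_insert_of_mem hi)
    have e : (fun t => ∑ i ∈ insert a s, F i t) = F a + fun t => ∑ i ∈ s, F i t := by
      funext t
      simp [Finset.sum_insert ha]
    rw [e, weilArchTerm_add_arch (hF a (Finset.mem_insert_self a s))
      (isWeilTest_finset_sum_arch s F hF'), ih hF', Finset.sum_insert ha]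

/-- The Diophantine gap between logarithms of distinct positive integers `q < p`:
`log p − log q ≥ 1/(q+1)`. -/
private theorem log_sub_log_ge_arch {p q : ℕ} (hq : 1 ≤ q) (hpq : q < p) :
    1 / ((q : ℝ) + 1) ≤ Real.log p - Real.log q := by
  have hq' : (0 : ℝ) < q := by exact_mod_cast hq
  have hq1 : (0 : ℝ) < q + 1 := by linarith
  have hp : ((q : ℝ) + 1) ≤ p := by exact_mod_cast hpq
  have h1 : Real.log ((q : ℝ) + 1) ≤ Real.log p := Real.log_le_log hq1 hp
  have h2 : 1 - ((q + 1 : ℝ) / q)⁻¹ ≤ Real.log ((q + 1 : ℝ) / q) :=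
    Real.one_sub_inv_le_log_of_pos (by positivity)
  rw [inv_div, Real.log_div hq1.ne' hq'.ne'] at h2
  have h3 : 1 - (q : ℝ) / (q + 1) = 1 / ((q : ℝ) + 1) := by
    field_simp
    ring
  linarith

/-- For distinct `m, m' ∈ [1, M]`: `|log m − log m'| ≥ 1/(M+1)`. -/
private theorem abs_log_sub_log_ge_arch {M m m' : ℕ} (hm : m ∈ Finset.Icc 1 M)
    (hm' : m' ∈ Finset.Icc 1 M) (hne : m ≠ m') :
    1 / ((M : ℝ) + 1) ≤ |Real.log m - Real.log m'| := by
  obtain ⟨hm1, hmM⟩ := Finset.mem_Icc.1 hm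
  obtain ⟨hm1', hmM'⟩ := Finset.mem_Icc.1 hm'
  rcases lt_or_gt_of_ne hne with h | h
  · -- `m < m'`
    have hg := log_sub_log_ge_arch hm1 h
    have hle : 1 / ((M : ℝ) + 1) ≤ 1 / ((m : ℝ) + 1) := by
      apply one_div_le_one_div_of_le (by positivity)
      have : (m : ℝ) ≤ M := by exact_mod_cast hmM
      linarith
    rw [abs_sub_comm, abs_of_nonneg (by linarith [hle.trans hg, show (0:ℝ) ≤ 1 / ((M:ℝ) + 1) by positivity])]
    exact hle.trans hg
  · -- `m' < m`
    have hg := log_sub_log_ge_arch hm1' h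
    have hle : 1 / ((M : ℝ) + 1) ≤ 1 / ((m' : ℝ) + 1) := by
      apply one_div_le_one_div_of_le (by positivity)
      have : (m' : ℝ) ≤ M := by exact_mod_cast hmM'
      linarith
    rw [abs_of_nonneg (by linarith [hle.trans hg, show (0:ℝ) ≤ 1 / ((M:ℝ) + 1) by positivity])]
    exact hle.trans hg

/-! ### The stub -/

/-- **Stub 7c — the archimedean term of the comb autocorrelation.**  From the autocorrelation
(Stub 4), the landed sharp diagonal (`stub_archDiag`) and off-diagonal kernel bound
(`stub_archOffdiag`): there is an absolute `C` with, for every Weil test `φ` supported in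
`[-1, 1]`, `0 < ε`, `M ≥ 1`, `8εM ≤ 1` and `a`,
`Re W_∞(k) ≥ ε⁻¹ ‖φ‖₂² (log(1/ε) − C) ‖a‖² − 2 ‖φ‖₂² (B_abs(a) + (Σ ‖a_m‖)²)`, `k = g ⋆ g̃`
(`W_∞` is linear over the `M²` translates `τ_{log m − log m'} ψ_ε`; diagonal `m = m'`:
`Re W_∞(ψ_ε) ≥ (log(1/ε) − C) ‖φ_ε‖₂²`, `‖φ_ε‖₂² = ε⁻¹‖φ‖₂²`; off-diagonal:
`|log m − log m'| ≥ 1/M ≥ 8ε`, `|W_∞(τ_x ψ_ε)| ≤ ‖φ‖₁² (1/|x| + 1)`, `‖φ‖₁² ≤ 2‖φ‖₂²`). -/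
theorem stub_arch :
    (∀ φ : ℝ → ℂ, IsWeilTest φ → ∀ ε : ℝ, 0 < ε → ∀ (M : ℕ) (a : ℕ → ℂ),
      weilConv (fun x : ℝ => ∑ m ∈ Finset.Icc 1 M, a m * ((ε : ℂ)⁻¹ * φ ((x - Real.log (m : ℝ)) / ε)))
          (weilReflect (fun x : ℝ => ∑ m ∈ Finset.Icc 1 M,
            a m * ((ε : ℂ)⁻¹ * φ ((x - Real.log (m : ℝ)) / ε)))) =
        fun t : ℝ => ∑ m ∈ Finset.Icc 1 M, ∑ m' ∈ Finset.Icc 1 M,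
          a m * conj (a m') *
            weilTranslate (weilConv (fun t : ℝ => (ε : ℂ)⁻¹ * φ (t / ε))
              (weilReflect (fun t : ℝ => (ε : ℂ)⁻¹ * φ (t / ε))))
              (Real.log (m : ℝ) - Real.log (m' : ℝ)) t) →
    ∃ C : ℝ, ∀ φ : ℝ → ℂ, IsWeilTest φ → tsupport φ ⊆ Set.Icc (-1) 1 →
      ∀ ε : ℝ, 0 < ε → ∀ (M : ℕ) (a : ℕ → ℂ), 1 ≤ M → 8 * ε * M ≤ 1 →
        ε⁻¹ * weilNorm2Sq φ * ((Real.log (1 / ε) - C) * ∑ m ∈ Finset.Icc 1 M, ‖a m‖ ^ 2) -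
            2 * weilNorm2Sq φ *
              ((∑ m ∈ Finset.Icc 1 M, ∑ m' ∈ (Finset.Icc 1 M).erase m,
                  ‖a m‖ * ‖a m'‖ / |Real.log m - Real.log m'|) +
                (∑ m ∈ Finset.Icc 1 M, ‖a m‖) ^ 2) ≤
          (weilArchTerm
            (weilConv (fun x : ℝ => ∑ m ∈ Finset.Icc 1 M,
                a m * ((ε : ℂ)⁻¹ * φ ((x - Real.log (m : ℝ)) / ε)))
              (weilReflect (fun x : ℝ => ∑ m ∈ Finset.Icc 1 M,
                a m * ((ε : ℂ)⁻¹ * φ ((x - Real.log (m : ℝ)) / ε)))))).re := by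
  intro hA
  obtain ⟨C, hC⟩ := stub_archDiag
  refine ⟨C, fun φ hφ hsupp ε hε M a hM h8 => ?_⟩
  -- notation
  set φε : ℝ → ℂ := fun t : ℝ => (ε : ℂ)⁻¹ * φ (t / ε) with hφε
  set ψ : ℝ → ℂ := weilConv φε (weilReflect φε) with hψ
  set N : ℝ := weilNorm2Sq φ with hN
  set N1 : ℝ := weilNorm1 φ with hN1
  set L : ℝ := ∑ m ∈ Finset.Icc 1 M, ‖a m‖ ^ 2 with hL
  set B : ℝ := ∑ m ∈ Finset.Icc 1 M, ∑ m' ∈ (Finset.Icc 1 M).erase m,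
      ‖a m‖ * ‖a m'‖ / |Real.log m - Real.log m'| with hB
  set A1 : ℝ := ∑ m ∈ Finset.Icc 1 M, ‖a m‖ with hA1
  have hφεW : IsWeilTest φε := isWeilTest_dil_arch hφ hε.ne'
  have hφεs : tsupport φε ⊆ Icc (-ε) ε := tsupport_dil_subset_arch hsupp hε
  have hψW : IsWeilTest ψ := hφεW.weilConv hφεW.weilReflect
  have hMr : (1 : ℝ) ≤ (M : ℝ) := by exact_mod_cast hM
  have hε1 : ε ≤ 1 := by nlinarith
  have hN0 : 0 ≤ N := weilNorm2Sq_nonneg φ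
  -- the diagonal value
  have hdiag : (Real.log (1 / ε) - C) * (ε⁻¹ * N) ≤ (weilArchTerm ψ).re := by
    have h := hC φε hφεW ε hε hε1 hφεs
    rwa [weilNorm2Sq_dil_arch φ hε] at h
  -- the off-diagonal bound
  have hoff : ∀ m ∈ Finset.Icc 1 M, ∀ m' ∈ (Finset.Icc 1 M).erase m,
      ‖weilArchTerm (weilTranslate ψ (Real.log m - Real.log m'))‖ ≤
        N1 ^ 2 * (1 / |Real.log m - Real.log m'| + 1) := by
    intro m hm m' hm'
    obtain ⟨hne, hm''⟩ := Finset.mem_erase.1 hm'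
    refine stub_archOffdiag φ hφ hsupp ε hε _ ?_
    have hgap := abs_log_sub_log_ge_arch hm hm'' (Ne.symm hne)
    have h1 : 4 * ε ≤ 1 / ((M : ℝ) + 1) := by
      rw [le_div_iff₀ (by positivity)]
      nlinarith
    exact h1.trans hgap
  -- Step 1: rewrite `k` by the autocorrelation and expand `W_∞` by linearity
  rw [hA φ hφ ε hε M a]
  have hterm : ∀ m m' : ℕ, IsWeilTest (fun t : ℝ =>
      a m * conj (a m') * weilTranslate ψ (Real.log (m : ℝ) - Real.log (m' : ℝ)) t) :=
    fun m m' => (hψW.weilTranslate _).const_mul _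
  have hinner : ∀ m : ℕ, IsWeilTest (fun t : ℝ => ∑ m' ∈ Finset.Icc 1 M,
      a m * conj (a m') * weilTranslate ψ (Real.log (m : ℝ) - Real.log (m' : ℝ)) t) :=
    fun m => isWeilTest_finset_sum_arch (Finset.Icc 1 M)
      (fun m' t => a m * conj (a m') * weilTranslate ψ (Real.log (m : ℝ) - Real.log (m' : ℝ)) t)
      (fun m' _ => hterm m m')
  have hlin : weilArchTerm (fun t : ℝ => ∑ m ∈ Finset.Icc 1 M, ∑ m' ∈ Finset.Icc 1 M,
      a m * conj (a m') * weilTranslate ψ (Real.log (m : ℝ) - Real.log (m' : ℝ)) t) =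
      ∑ m ∈ Finset.Icc 1 M, ∑ m' ∈ Finset.Icc 1 M,
        a m * conj (a m') * weilArchTerm (weilTranslate ψ (Real.log (m : ℝ) - Real.log (m' : ℝ))) := by
    rw [weilArchTerm_finset_sum_arch (Finset.Icc 1 M)
      (fun m t => ∑ m' ∈ Finset.Icc 1 M,
        a m * conj (a m') * weilTranslate ψ (Real.log (m : ℝ) - Real.log (m' : ℝ)) t)
      (fun m _ => hinner m)]
    refine Finset.sum_congr rfl fun m _ => ?_
    rw [weilArchTerm_finset_sum_arch (Finset.Icc 1 M)
      (fun m' t => a m * conj (a m') * weilTranslate ψ (Real.log (m : ℝ) - Real.log (m' : ℝ)) t)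
      (fun m' _ => hterm m m')]
    refine Finset.sum_congr rfl fun m' _ => ?_
    exact weilArchTerm_const_mul_arch _ _
  rw [hlin, Complex.re_sum]
  simp_rw [Complex.re_sum]
  -- Step 2: termwise lower bounds
  set T : ℕ → ℕ → ℂ := fun m m' =>
    a m * conj (a m') * weilArchTerm (weilTranslate ψ (Real.log (m : ℝ) - Real.log (m' : ℝ))) with hT
  have hTdiag : ∀ m : ℕ, (T m m).re = ‖a m‖ ^ 2 * (weilArchTerm ψ).re := by
    intro m
    have e0 : weilTranslate ψ (Real.log (m : ℝ) - Real.log (m : ℝ)) = ψ := by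
      funext t
      simp [weilTranslate]
    simp only [hT, e0, Complex.mul_conj, Complex.normSq_eq_norm_sq]
    exact Complex.re_ofReal_mul _ _
  have hToff : ∀ m ∈ Finset.Icc 1 M, ∀ m' ∈ (Finset.Icc 1 M).erase m,
      -(N1 ^ 2 * (‖a m‖ * ‖a m'‖ / |Real.log m - Real.log m'| + ‖a m‖ * ‖a m'‖)) ≤ (T m m').re := by
    intro m hm m' hm'
    have h1 : -‖T m m'‖ ≤ (T m m').re := (abs_le.1 (Complex.abs_re_le_norm _)).1
    have h2 : ‖T m m'‖ ≤ ‖a m‖ * ‖a m'‖ * (N1 ^ 2 * (1 / |Real.log m - Real.log m'| + 1)) := by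
      simp only [hT, norm_mul, Complex.norm_conj]
      exact mul_le_mul_of_nonneg_left (hoff m hm m' hm') (by positivity)
    have e : ‖a m‖ * ‖a m'‖ * (N1 ^ 2 * (1 / |Real.log m - Real.log m'| + 1)) =
        N1 ^ 2 * (‖a m‖ * ‖a m'‖ / |Real.log m - Real.log m'| + ‖a m‖ * ‖a m'‖) := by ring
    linarith
  have hrow : ∀ m ∈ Finset.Icc 1 M,
      ‖a m‖ ^ 2 * ((Real.log (1 / ε) - C) * (ε⁻¹ * N)) -
        N1 ^ 2 * ∑ m' ∈ (Finset.Icc 1 M).erase m,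
          (‖a m‖ * ‖a m'‖ / |Real.log m - Real.log m'| + ‖a m‖ * ‖a m'‖) ≤
      ∑ m' ∈ Finset.Icc 1 M, (T m m').re := by
    intro m hm
    rw [← Finset.add_sum_erase _ _ hm, hTdiag m, Finset.mul_sum]
    have h1 : ‖a m‖ ^ 2 * ((Real.log (1 / ε) - C) * (ε⁻¹ * N)) ≤ ‖a m‖ ^ 2 * (weilArchTerm ψ).re :=
      mul_le_mul_of_nonneg_left hdiag (sq_nonneg _)
    have h2 : -(∑ m' ∈ (Finset.Icc 1 M).erase m,
        N1 ^ 2 * (‖a m‖ * ‖a m'‖ / |Real.log m - Real.log m'| + ‖a m‖ * ‖a m'‖)) ≤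
        ∑ m' ∈ (Finset.Icc 1 M).erase m, (T m m').re := by
      rw [← Finset.sum_neg_distrib]
      exact Finset.sum_le_sum fun m' hm' => hToff m hm m' hm'
    linarith
  have hsum : ∑ m ∈ Finset.Icc 1 M, (‖a m‖ ^ 2 * ((Real.log (1 / ε) - C) * (ε⁻¹ * N)) -
        N1 ^ 2 * ∑ m' ∈ (Finset.Icc 1 M).erase m,
          (‖a m‖ * ‖a m'‖ / |Real.log m - Real.log m'| + ‖a m‖ * ‖a m'‖)) ≤
      ∑ m ∈ Finset.Icc 1 M, ∑ m' ∈ Finset.Icc 1 M, (T m m').re :=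
    Finset.sum_le_sum hrow
  -- Step 3: evaluate the left-hand side
  have hlhs : ∑ m ∈ Finset.Icc 1 M, (‖a m‖ ^ 2 * ((Real.log (1 / ε) - C) * (ε⁻¹ * N)) -
        N1 ^ 2 * ∑ m' ∈ (Finset.Icc 1 M).erase m,
          (‖a m‖ * ‖a m'‖ / |Real.log m - Real.log m'| + ‖a m‖ * ‖a m'‖)) =
      L * ((Real.log (1 / ε) - C) * (ε⁻¹ * N)) -
        N1 ^ 2 * (B + ∑ m ∈ Finset.Icc 1 M, ∑ m' ∈ (Finset.Icc 1 M).erase m, ‖a m‖ * ‖a m'‖) := by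
    rw [Finset.sum_sub_distrib, ← Finset.sum_mul, ← Finset.mul_sum, hB, ← Finset.sum_add_distrib]
    congr 2
    refine Finset.sum_congr rfl fun m _ => ?_
    rw [Finset.sum_add_distrib]
  -- the off-diagonal mass is at most `(Σ ‖a_m‖)²`
  have hoffsum : ∑ m ∈ Finset.Icc 1 M, ∑ m' ∈ (Finset.Icc 1 M).erase m, ‖a m‖ * ‖a m'‖ ≤ A1 ^ 2 := by
    rw [sq, hA1, Finset.sum_mul_sum]
    refine Finset.sum_le_sum fun m _ => ?_
    exact Finset.sum_le_sum_of_subset_of_nonneg (Finset.erase_subset _ _)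
      fun m' _ _ => by positivity
  have hB0 : 0 ≤ B := by
    rw [hB]
    exact Finset.sum_nonneg fun _ _ => Finset.sum_nonneg fun _ _ => by positivity
  have hN1sq : N1 ^ 2 ≤ 2 * N := by
    have h := weilNorm1_sq_le hφ one_pos hsupp
    linarith
  have hN1sq0 : 0 ≤ N1 ^ 2 := sq_nonneg _
  -- assemble
  have key : ε⁻¹ * N * ((Real.log (1 / ε) - C) * L) - 2 * N * (B + A1 ^ 2) ≤
      L * ((Real.log (1 / ε) - C) * (ε⁻¹ * N)) -
        N1 ^ 2 * (B + ∑ m ∈ Finset.Icc 1 M, ∑ m' ∈ (Finset.Icc 1 M).erase m, ‖a m‖ * ‖a m'‖) := by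
    have h1 : N1 ^ 2 * (B + ∑ m ∈ Finset.Icc 1 M, ∑ m' ∈ (Finset.Icc 1 M).erase m, ‖a m‖ * ‖a m'‖) ≤
        2 * N * (B + A1 ^ 2) := by
      have hO0 : 0 ≤ ∑ m ∈ Finset.Icc 1 M, ∑ m' ∈ (Finset.Icc 1 M).erase m, ‖a m‖ * ‖a m'‖ :=
        Finset.sum_nonneg fun _ _ => Finset.sum_nonneg fun _ _ => by positivity
      calc N1 ^ 2 * (B + ∑ m ∈ Finset.Icc 1 M, ∑ m' ∈ (Finset.Icc 1 M).erase m, ‖a m‖ * ‖a m'‖)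
          ≤ N1 ^ 2 * (B + A1 ^ 2) := mul_le_mul_of_nonneg_left (by linarith) hN1sq0
        _ ≤ 2 * N * (B + A1 ^ 2) := mul_le_mul_of_nonneg_right hN1sq (by positivity)
    nlinarith [h1]
  calc ε⁻¹ * N * ((Real.log (1 / ε) - C) * L) - 2 * N * (B + A1 ^ 2)
      ≤ L * ((Real.log (1 / ε) - C) * (ε⁻¹ * N)) -
        N1 ^ 2 * (B + ∑ m ∈ Finset.Icc 1 M, ∑ m' ∈ (Finset.Icc 1 M).erase m, ‖a m‖ * ‖a m'‖) := key
    _ = _ := hlhs.symm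
    _ ≤ ∑ m ∈ Finset.Icc 1 M, ∑ m' ∈ Finset.Icc 1 M, (T m m').re := hsum

end Summit.RiemannHypothesis.RiemannHypothesis.Theorems.WeilCombSubcritical

end
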